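import Summits.BirchSwinnertonDyer.Rank1Residual.X1.RankOneCongruenceTransfer
import Summits.BirchSwinnertonDyer.Rank1Residual.X1.RankOneCoefficientCertificate
import HarnessLib

/-!
# Route G at RANK ONE on class X1, sequel: Mazur's main conjecture from a closed congruent relative
# (`X1/RankOneCongruenceTransfer.lean`) + the Schneider certificate ⇒ `BSD(E,p)` with NO `#Ш(E/ℚ)_an`
# input; and the type-B forms (Greenberg–Vatsal + certificate, no partner, no `#Ш_an`)

HONEST FRAMING (cell `b2b-bsdres`, run/shared/lean/b2b/bsd-rank1-residual/, verbatim in every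
file): the goal of the cell is to DELETE the COMBINATION-SHAPED residual classes of the
Birch–Swinnerton-Dyer formula for ALL analytic-rank `≤ 1` elliptic curves over `ℚ` — "full BSD
formula for every rank `≤ 1` curve in class `C`" assembled STRICTLY from published theorems — so
that the rank-`≤ 1` remainder becomes exactly the CONSTRUCTION-SHAPED classes, which are TYPED
(missing-input `Prop`s), NOT attempted. This is not "finishing BSD". Unit `b2b-bsdres-x1a` (X1 prover
A; CLASS-OWNERS row "X1 (r = 1)"), gen 11: research route; NO CLAIM BEYOND STATED CLASSES; nothing
here changes a label; no new named fact, no new def (theorems only).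

* §3 `BSD(E,p)` on the rank-one leaf: Mazur's main conjecture by route G
  (`RankOne.Leaf.mazurMainConjecture_of_congruent`) + Schneider's non-degeneracy at the pair (x1a
  `RankOne.Leaf.bsdp_of_mazurMainConjecture_of_schneider`: Perrin-Riou–Schneider, Perrin-Riou 1987,
  Mazur–Tate `σ`, modularity, GZK — all PUBLISHED), the certificate in its three currencies:
  `SchneiderConjecture` at THE canonical height, `[T¹]L_p(f,α) ≠ 0`, `p^{-v} ≤ ‖[T¹](ϖ·L_p(f,α))‖_p`.
  **No `#Ш(E/ℚ)_an` enters**: route B's per-pair form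
  (`RankOne.Leaf.mazurMainConjecture_and_bsdp_of_shaAn_unit_of_coeff_one_ne_zero`) needs `p ∤ #Ш_an` to
  turn Kato–Wuthrich divisibility into the main conjecture; here the main conjecture is TRANSFERRED.
* §4 TYPE B needs no partner and no `#Ш_an` either: Greenberg–Vatsal Thm. (1.3) IS Mazur's main
  conjecture there (`RankOne.Leaf.mazurMainConjecture_of_gvPar`), so `GVPar` + the certificate ⇒ Mazur's
  MC ∧ `BSD(E,p)` — the packaged form of x1a gen 9's `RankOne.Leaf.bsdp_of_gvPar_of_schneider` in
  certificate currency (Burungale–Skinner 2023 Thm. 3.1 prints this argument with the non-degeneracy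
  supplied by `λ = 1`; on the anomalous leaf `λ_an ≥ 3` on type B, X1-CHAIN §17c, so the certificate is a
  genuine `p`-adic computation). Census pointer (not a verdict): the ONE lane-open rank-one X1 class-pair
  with `N < 5·10⁵` on which route B's `p ∤ #Ш_an` clause fails, `371522j@3` (`#Ш_an = 9` on both curves),
  is of type B (x1a LW-FALLOUT-X1 §3).

What this is NOT: a class theorem (partner, transfer datum and certificate are per pair); a change of the
class-level residue (X1-CHAIN §17b: A1 = Mazur's MC at anomalous type-A pairs — unstated in print,
Keller–Yin PRE — plus Schneider; B1 = Schneider).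

References: [GreenbergVatsal2000] Thm. (1.3), §2 p. 27; [GreenbergLNM1716] Prop. 3.10; [Wuthrich2014]
Thm. 16; [BalakrishnanMullerStein2015] Thm. 1.7; [PerrinRiou1987] §1.4 Cor. 1.8; [SteinWuthrich2013]
§§3–4, §9; [BurungaleSkinner2023] Thm. 3.1; HOME/b2b-bsdres-x1a/X1-CHAIN.md §17b–c, §20.
-/

noncomputable section

open scoped Classical MatrixGroups ModularForm

open PowerSeries CongruenceSubgroup WeierstrassCurve Literature.NumberTheory.EllipticCurves
  Literature.NumberTheory.EllipticCurves.ModularForms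
  Literature.NumberTheory.EllipticCurves.Wuthrich2014
  Literature.NumberTheory.EllipticCurves.Rank1Residual
  Literature.NumberTheory.EllipticCurves.Greenberg1999
  Summit.BirchSwinnertonDyer.BirchSwinnertonDyer.Theorems
  Summit.BirchSwinnertonDyer.BirchSwinnertonDyer.Theorems.Rank1ResidualX1Defs
  Summit.BirchSwinnertonDyer.Rank1Residual.X1.MuLambda
  Summit.BirchSwinnertonDyer.Rank1Residual.X1.MuPart
  Summit.BirchSwinnertonDyer.Rank1Residual.X1.ParitySqueeze
  Summit.BirchSwinnertonDyer.Rank1Residual.X1.CongruenceTransfer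

set_option autoImplicit false

namespace Summit.BirchSwinnertonDyer.Rank1Residual.X1.RankOneCongruenceTransfer

/-! ## §3. `BSD(E,p)` on the rank-one leaf: route G + the Schneider certificate — no `#Ш(E/ℚ)_an` -/

section BSD

variable {W W' : WeierstrassCurve ℚ} [W.IsElliptic] [W.IsGloballyMinimal]
  [W'.IsElliptic] [W'.IsGloballyMinimal] {p : ℕ} [Fact p.Prime]

/-- **Route G ⇒ Mazur's main conjecture ∧ `BSD(E₀,p)` on the rank-one leaf, modulo Schneider at the
pair.** Mazur's main conjecture by `RankOne.Leaf.mazurMainConjecture_of_congruent`; `BSD(E,p)` by x1a's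
`RankOne.Leaf.bsdp_of_mazurMainConjecture_of_schneider` (Perrin-Riou–Schneider `hS`, Perrin-Riou 1987
`hPR`, Mazur–Tate sigma `hMT`, modularity, GZK — all PUBLISHED) with Schneider's non-degeneracy of THE
canonical cyclotomic height at the pair (`hSch`). NO `#Ш(E/ℚ)_an` input (contrast route B's
`RankOne.Leaf.mazurMainConjecture_and_bsdp_of_shaAn_unit_of_schneider`): the main conjecture is
transferred, not deduced from `p ∤ #Ш_an`. [cite: GreenbergVatsal2000, §2 p. 27]
[cite: GreenbergLNM1716, Prop. 3.10] [cite: Wuthrich2014, Thm. 16 (p. 397)]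
[cite: BalakrishnanMullerStein2015, Thm. 1.7] [cite: PerrinRiou1987, §1.4 Cor. 1.8] -/
theorem _root_.Summit.BirchSwinnertonDyer.Rank1Residual.X1.RankOne.Leaf.mazurMainConjecture_and_bsdp_of_congruent_of_schneider
    (hW16 : Wuthrich2014.charIdeal_dvd_padicLFunction)
    (h310 : prop310_selmerCorank_mod_two_eq_lambdaInvariant)
    (hS : Schneider1985_order_charGenerator_odd) (hPR : perrinRiou_rankOne_leadingTerms_odd)
    (hMT : mazur_tate_sigma_exists_odd) (hmod : nonempty_modularParametrizationData)
    (hGZK : rank_eq_analyticRank_of_analyticRank_le_one) (hL : RankOne.Leaf W p)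
    (hgood' : W'.HasGoodReductionAtPrime p) (hord' : ¬ (p : ℤ) ∣ W'.frobeniusTrace p)
    (hred' : ¬ W'.HasIrreducibleModPGaloisRep p)
    (hμ : AnalyticMuLE W p 0) (hμ' : AnalyticMuLE W' p 0)
    (hMC' : MazurMainConjecture W' p) {n' : ℕ} (hlam' : AnalyticLambdaEq W' p n')
    (hiso : TorsionIso W W' p) {e : ℤ} (hG : CongruentLambdaShift W W' p e)
    {n : ℕ} (hlam : AnalyticLambdaEq W p n) (hne : (n : ℤ) ≤ n' + e + 1)
    (hSch : ∀ Dh : PAdicHeightData W p, Dh.IsCanonical → SchneiderConjecture Dh) :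
    MazurMainConjecture W p ∧ BSDp W p :=
  have hMC : MazurMainConjecture W p :=
    hL.mazurMainConjecture_of_congruent hW16 h310 hmod hGZK hgood' hord' hred' hμ hμ' hMC' hlam' hiso
      hG hlam hne
  ⟨hMC, hL.bsdp_of_mazurMainConjecture_of_schneider hS hPR hMT hmod hGZK hSch hMC⟩

/-- **Route G in certificate currency: closed congruent partner + `[T¹]L_p(f,α,T) ≠ 0` (for SOME newform
`f` of `E₀`) ⇒ Mazur's main conjecture ∧ `BSD(E₀,p)`** on the rank-one leaf; Schneider at the pair by
x1a's converter `RankOne.Leaf.schneider_of_coeff_one_ne_zero` (Perrin-Riou 1987 + GZK). No `#Ш_an`, no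
`p`-adic height computation, no Heegner index. [cite: GreenbergVatsal2000, §2 p. 27]
[cite: PerrinRiou1987, §1.4 Cor. 1.8] [cite: SteinWuthrich2013, §§3–4, §9]
[cite: Wuthrich2014, Thm. 16 (p. 397)] -/
theorem _root_.Summit.BirchSwinnertonDyer.Rank1Residual.X1.RankOne.Leaf.mazurMainConjecture_and_bsdp_of_congruent_of_coeff_one_ne_zero
    (hW16 : Wuthrich2014.charIdeal_dvd_padicLFunction)
    (h310 : prop310_selmerCorank_mod_two_eq_lambdaInvariant)
    (hS : Schneider1985_order_charGenerator_odd) (hPR : perrinRiou_rankOne_leadingTerms_odd)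
    (hMT : mazur_tate_sigma_exists_odd) (hmod : nonempty_modularParametrizationData)
    (hGZK : rank_eq_analyticRank_of_analyticRank_le_one) (hL : RankOne.Leaf W p)
    (hgood' : W'.HasGoodReductionAtPrime p) (hord' : ¬ (p : ℤ) ∣ W'.frobeniusTrace p)
    (hred' : ¬ W'.HasIrreducibleModPGaloisRep p)
    (hμ : AnalyticMuLE W p 0) (hμ' : AnalyticMuLE W' p 0)
    (hMC' : MazurMainConjecture W' p) {n' : ℕ} (hlam' : AnalyticLambdaEq W' p n')
    (hiso : TorsionIso W W' p) {e : ℤ} (hG : CongruentLambdaShift W W' p e)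
    {n : ℕ} (hlam : AnalyticLambdaEq W p n) (hne : (n : ℤ) ≤ n' + e + 1)
    {N : ℕ} [NeZero N] (f : CuspForm (Gamma0 N) 2) (hf : IsNewformOf W f)
    (hcoeff : coeff 1 (padicLFunction f (unitRoot W p : ℚ_[p])) ≠ 0) :
    MazurMainConjecture W p ∧ BSDp W p :=
  hL.mazurMainConjecture_and_bsdp_of_congruent_of_schneider hW16 h310 hS hPR hMT hmod hGZK hgood' hord'
    hred' hμ hμ' hMC' hlam' hiso hG hlam hne (hL.schneider_of_coeff_one_ne_zero hPR hGZK f hf hcoeff)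

/-- **`BSD(E₀,p)` half**, partner read off `ClassX1 W' p` (the census case).
[cite: GreenbergVatsal2000, §2 p. 27] [cite: PerrinRiou1987, §1.4 Cor. 1.8]
[cite: Wuthrich2014, Thm. 16 (p. 397)] -/
theorem _root_.Summit.BirchSwinnertonDyer.Rank1Residual.X1.RankOne.Leaf.bsdp_of_congruent_classX1_of_coeff_one_ne_zero
    (hW16 : Wuthrich2014.charIdeal_dvd_padicLFunction)
    (h310 : prop310_selmerCorank_mod_two_eq_lambdaInvariant)
    (hS : Schneider1985_order_charGenerator_odd) (hPR : perrinRiou_rankOne_leadingTerms_odd)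
    (hMT : mazur_tate_sigma_exists_odd) (hmod : nonempty_modularParametrizationData)
    (hGZK : rank_eq_analyticRank_of_analyticRank_le_one) (hL : RankOne.Leaf W p)
    (hX1' : ClassX1 W' p) (hμ : AnalyticMuLE W p 0) (hμ' : AnalyticMuLE W' p 0)
    (hMC' : MazurMainConjecture W' p) {n' : ℕ} (hlam' : AnalyticLambdaEq W' p n')
    (hiso : TorsionIso W W' p) {e : ℤ} (hG : CongruentLambdaShift W W' p e)
    {n : ℕ} (hlam : AnalyticLambdaEq W p n) (hne : (n : ℤ) ≤ n' + e + 1)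
    {N : ℕ} [NeZero N] (f : CuspForm (Gamma0 N) 2) (hf : IsNewformOf W f)
    (hcoeff : coeff 1 (padicLFunction f (unitRoot W p : ℚ_[p])) ≠ 0) : BSDp W p :=
  have hP := partner_of_classX1 hX1'
  (hL.mazurMainConjecture_and_bsdp_of_congruent_of_coeff_one_ne_zero hW16 h310 hS hPR hMT hmod hGZK hP.1
    hP.2.1 hP.2.2 hμ hμ' hMC' hlam' hiso hG hlam hne f hf hcoeff).2

/-- **Route G in the finite-precision currency a modular-symbol engine certifies:
`p^{-v} ≤ ‖[T¹](ϖ·L_p(f,α))‖_p`** for some `v : ℕ` and scalar `ϖ` (x1a gen 10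
`RankOne.coeff_one_ne_zero_of_le_norm_coeff_one_smul`) + closed congruent partner ⇒ Mazur's MC ∧
`BSD(E₀,p)`. [cite: GreenbergVatsal2000, §2 p. 27] [cite: PerrinRiou1987, §1.4 Cor. 1.8]
[cite: SteinWuthrich2013, §§3–4, §9] [cite: Wuthrich2014, Thm. 16 (p. 397)] -/
theorem _root_.Summit.BirchSwinnertonDyer.Rank1Residual.X1.RankOne.Leaf.mazurMainConjecture_and_bsdp_of_congruent_of_le_norm_coeff_one
    (hW16 : Wuthrich2014.charIdeal_dvd_padicLFunction)
    (h310 : prop310_selmerCorank_mod_two_eq_lambdaInvariant)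
    (hS : Schneider1985_order_charGenerator_odd) (hPR : perrinRiou_rankOne_leadingTerms_odd)
    (hMT : mazur_tate_sigma_exists_odd) (hmod : nonempty_modularParametrizationData)
    (hGZK : rank_eq_analyticRank_of_analyticRank_le_one) (hL : RankOne.Leaf W p)
    (hgood' : W'.HasGoodReductionAtPrime p) (hord' : ¬ (p : ℤ) ∣ W'.frobeniusTrace p)
    (hred' : ¬ W'.HasIrreducibleModPGaloisRep p)
    (hμ : AnalyticMuLE W p 0) (hμ' : AnalyticMuLE W' p 0)
    (hMC' : MazurMainConjecture W' p) {n' : ℕ} (hlam' : AnalyticLambdaEq W' p n')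
    (hiso : TorsionIso W W' p) {e : ℤ} (hG : CongruentLambdaShift W W' p e)
    {n : ℕ} (hlam : AnalyticLambdaEq W p n) (hne : (n : ℤ) ≤ n' + e + 1)
    {N : ℕ} [NeZero N] (f : CuspForm (Gamma0 N) 2) (hf : IsNewformOf W f) (ϖ : ℚ_[p]) (v : ℕ)
    (hcoeff : (p : ℝ) ^ (-(v : ℤ)) ≤ ‖coeff 1 (C ϖ * padicLFunction f (unitRoot W p : ℚ_[p]))‖) :
    MazurMainConjecture W p ∧ BSDp W p :=
  have hpP : p.Prime := Fact.out
  hL.mazurMainConjecture_and_bsdp_of_congruent_of_coeff_one_ne_zero hW16 h310 hS hPR hMT hmod hGZK hgood'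
    hord' hred' hμ hμ' hMC' hlam' hiso hG hlam hne f hf
    (RankOne.coeff_one_ne_zero_of_le_norm_coeff_one_smul _ ϖ (zpow_pos (by exact_mod_cast hpP.pos) _)
      hcoeff)

end BSD

/-! ## §4. Type B needs no partner and no `#Ш_an`: Greenberg–Vatsal + the certificate -/

section TypeB

variable {W : WeierstrassCurve ℚ} [W.IsElliptic] [W.IsGloballyMinimal] {p : ℕ} [Fact p.Prime]

/-- **Type B on the rank-one leaf: `GVPar` + `[T¹]L_p(f,α,T) ≠ 0` ⇒ Mazur's main conjecture ∧ `BSD(E,p)`,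
with NO `#Ш(E/ℚ)_an` input.** Mazur's main conjecture IS Greenberg–Vatsal's Thm. (1.3) at a type-B pair
(`RankOne.Leaf.mazurMainConjecture_of_gvPar`); `BSD(E,p)` by x1a gen 9's `RankOne.Leaf.bsdp_of_gvPar_of_schneider`
(= Burungale–Skinner 2023 Thm. 3.1's printed argument with the non-degeneracy supplied per pair) and the
converter `RankOne.Leaf.schneider_of_coeff_one_ne_zero`. Census pointer (not a verdict): the only lane-open
rank-one X1 class-pair with `N < 5·10⁵` where route B's `p ∤ #Ш_an` clause fails, `371522j@3`
(`#Ш_an = 9` on both curves), is of type B (x1a LW-FALLOUT-X1 §3). [cite: GreenbergVatsal2000, Thm. (1.3)]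
[cite: BurungaleSkinner2023, Thm. 3.1 (p. 25)] [cite: PerrinRiou1987, §1.4 Cor. 1.8]
[cite: BalakrishnanMullerStein2015, Thm. 1.7] -/
theorem _root_.Summit.BirchSwinnertonDyer.Rank1Residual.X1.RankOne.Leaf.mazurMainConjecture_and_bsdp_of_gvPar_of_coeff_one_ne_zero
    (hGV : GreenbergVatsal2000.thm13_charIdeal_eq_of_gvPar)
    (hS : Schneider1985_order_charGenerator_odd) (hPR : perrinRiou_rankOne_leadingTerms_odd)
    (hMT : mazur_tate_sigma_exists_odd) (hmod : nonempty_modularParametrizationData)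
    (hGZK : rank_eq_analyticRank_of_analyticRank_le_one) (hL : RankOne.Leaf W p) (hB : GVPar W p)
    {N : ℕ} [NeZero N] (f : CuspForm (Gamma0 N) 2) (hf : IsNewformOf W f)
    (hcoeff : coeff 1 (padicLFunction f (unitRoot W p : ℚ_[p])) ≠ 0) :
    MazurMainConjecture W p ∧ BSDp W p :=
  ⟨hL.mazurMainConjecture_of_gvPar hGV hB,
    hL.bsdp_of_gvPar_of_schneider hGV hS hPR hMT hmod hGZK hB
      (hL.schneider_of_coeff_one_ne_zero hPR hGZK f hf hcoeff)⟩

/-- **Type B, finite-precision currency: `GVPar` + `p^{-v} ≤ ‖[T¹](ϖ·L_p(f,α))‖_p` ⇒ Mazur's MC ∧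
`BSD(E,p)`**, no `#Ш_an`. [cite: GreenbergVatsal2000, Thm. (1.3)] [cite: PerrinRiou1987, §1.4 Cor. 1.8]
[cite: SteinWuthrich2013, §§3–4, §9] -/
theorem _root_.Summit.BirchSwinnertonDyer.Rank1Residual.X1.RankOne.Leaf.mazurMainConjecture_and_bsdp_of_gvPar_of_le_norm_coeff_one
    (hGV : GreenbergVatsal2000.thm13_charIdeal_eq_of_gvPar)
    (hS : Schneider1985_order_charGenerator_odd) (hPR : perrinRiou_rankOne_leadingTerms_odd)
    (hMT : mazur_tate_sigma_exists_odd) (hmod : nonempty_modularParametrizationData)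
    (hGZK : rank_eq_analyticRank_of_analyticRank_le_one) (hL : RankOne.Leaf W p) (hB : GVPar W p)
    {N : ℕ} [NeZero N] (f : CuspForm (Gamma0 N) 2) (hf : IsNewformOf W f) (ϖ : ℚ_[p]) (v : ℕ)
    (hcoeff : (p : ℝ) ^ (-(v : ℤ)) ≤ ‖coeff 1 (C ϖ * padicLFunction f (unitRoot W p : ℚ_[p]))‖) :
    MazurMainConjecture W p ∧ BSDp W p :=
  have hpP : p.Prime := Fact.out
  hL.mazurMainConjecture_and_bsdp_of_gvPar_of_coeff_one_ne_zero hGV hS hPR hMT hmod hGZK hB f hf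
    (RankOne.coeff_one_ne_zero_of_le_norm_coeff_one_smul _ ϖ (zpow_pos (by exact_mod_cast hpP.pos) _)
      hcoeff)

/-- **Type B in height currency, both conclusions packaged: `GVPar` + Schneider at the pair ⇒ Mazur's MC ∧
`BSD(E,p)`** (x1a gen 9's `RankOne.Leaf.bsdp_of_gvPar_of_schneider` with Greenberg–Vatsal's main conjecture
recorded alongside; the lane's two height engines give the certificate per pair). No `#Ш_an`.
[cite: GreenbergVatsal2000, Thm. (1.3)] [cite: BalakrishnanMullerStein2015, Thm. 1.7]
[cite: PerrinRiou1987, §1.4 Cor. 1.8] -/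
theorem _root_.Summit.BirchSwinnertonDyer.Rank1Residual.X1.RankOne.Leaf.mazurMainConjecture_and_bsdp_of_gvPar_of_schneider
    (hGV : GreenbergVatsal2000.thm13_charIdeal_eq_of_gvPar)
    (hS : Schneider1985_order_charGenerator_odd) (hPR : perrinRiou_rankOne_leadingTerms_odd)
    (hMT : mazur_tate_sigma_exists_odd) (hmod : nonempty_modularParametrizationData)
    (hGZK : rank_eq_analyticRank_of_analyticRank_le_one) (hL : RankOne.Leaf W p) (hB : GVPar W p)
    (hSch : ∀ Dh : PAdicHeightData W p, Dh.IsCanonical → SchneiderConjecture Dh) :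
    MazurMainConjecture W p ∧ BSDp W p :=
  ⟨hL.mazurMainConjecture_of_gvPar hGV hB, hL.bsdp_of_gvPar_of_schneider hGV hS hPR hMT hmod hGZK hB hSch⟩

end TypeB

end Summit.BirchSwinnertonDyer.Rank1Residual.X1.RankOneCongruenceTransfer

end
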